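/-
Copyright (c) 2026. All rights reserved.
Released under Apache 2.0 license as described in the file LICENSE.
-/
import Literature.AlgebraicGeometry.ComplexMultiplication.HyperellipticJacobianCrossLevelOrthogonality
import Literature.AlgebraicGeometry.ComplexMultiplication.HyperellipticJacobianTwiceOddJacobian
import Literature.AlgebraicGeometry.Motives.AbelianVarietyKernelComponent
import Literature.AlgebraicGeometry.Motives.AbelianVarietyIsogenyCancellation
import Literature.AlgebraicGeometry.HodgeTheory.AbelianVarietyIsogenySublatticesCohomology
import HarnessLib

/-!
# `X_{12} ∼ X_4 × X_4`: the factor of level `12` of `J_m = Jac(y² = x^m + 1)`, `12 ∣ m`, is isogenous to the square of the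
# factor of level `4` (GGL 2024 Thm. 3.0 (5) at `d = 12`, made explicit), so `End⁰(X_{12}) ≅ Mat₂(ℚ(ζ_4))` and
# `rk Hom(X_4, X_{12}) = 4`

Layer `Literature/AlgebraicGeometry/ComplexMultiplication`, namespace `…ComplexMultiplication.HyperellipticJacobian`; the sequel of
`HyperellipticJacobianCrossLevelOrthogonality` §3 (`Hom(X_4, X_{12}) ≠ 0` both ways: the compatible pair `(e = 1, e = 1)`) and of
`HyperellipticJacobianLevelDivisibleByFour` (GGL Thm. 3.0 (5): every realisation of `Φ_m`, `4 ∣ m ≥ 8` non-exceptional, is isogenous to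
`Y × Y` with `Y` a SIMPLE realisation of the primitive sub-pair `(ℚ(ζ_m − ζ_m⁻¹); Φ₁)` — tree `exists_isogeny_sq_simple_of_four_dvd`).
THEOREMS ONLY (no definition, no named fact, no `sorry`, no instance).

## The print and the point

A. Gallese, H. Goodson, D. Lombardo, arXiv:2405.20394 [GalleseGoodsonLombardo2024] §3 THM. 3.0 (held `paper:arxiv-2405.20394` p0012):
(5) «if `d = 4k` with `d ≠ 20, 24, 60`, then `X_d ∼ Y_d²` is isogenous to the square of a simple abelian variety `Y_d` with complex
multiplication by `ℚ(ζ_d − ζ_d^{−1})`» and «all `X_d` with odd `d` and all `Y_d` are pairwise non-isogenous».  At `d = 12`: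
`ℚ(ζ_{12} − ζ_{12}⁻¹) = ℚ(i) = ℚ(ζ_4)` (`ζ_{12} − ζ_{12}⁻¹ = 2i sin(π/6) = i`), and `Y_{12}` is an elliptic curve with CM by `ℚ(i)`, hence
isogenous (over `ℂ`) to `X_4 = Jac(y² = x⁴ + 1)`, the CM elliptic curve of `ℚ(i)`: **`X_{12} ∼ X_4 × X_4`**.  So inside `J_{12} ∼
X_3 × X_4 × X_6 × X_{12} ∼ X_3² × X_4³` the factors of levels `4` and `12` are NOT orthogonal (F12 §3), `End⁰(J_{12}) ≅ Mat₂(ℚ(ζ_3)) ×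
Mat₃(ℚ(i))`, and the print's list of pairwise non-isogenous factors must identify `Y_{12}` with `X_4` (Thm. 3.0 (5) does not apply
literally at `d = 4`, where `X_4` itself is the simple factor).

## The argument (Milne CM Prop. 3.13, Mumford §19 Cor. 2 of Thm. 1, Shimura §6.2 Thm. 3)

`A₁₂ ∼ P ≅ B ⊕ B` with `B` simple of dimension `1` realising the primitive sub-pair `(K₁; Φ₁)`, `Φ_{12} = Φ₁^{ℚ(ζ_{12})}` (tree, Thm. 3.0 (5));
the compatible pair for `(Φ_4, Φ_{12})` restricts to one for `(Φ_4, Φ₁)` (`τt ∈ Φ₁^K ⟺ τ(t|_{K₁}) ∈ Φ₁`), so `Hom(B, A₄) ≠ 0` (Riemann,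
tree `IsCMTypeRealisation.exists_hom_ne_zero_iff`); `A₄` is simple (every type of `ℚ(i)` is primitive), so a non-zero `B → A₄` is an
ISOGENY (Mumford §19 Cor. 2 of Thm. 1, tree `isIsogeny_of_isSimple_of_ne_zero`); hence `A₁₂ → P ≅ B ⊕ B → A₄ ⊕ A₄` is an isogeny.

## What is proved

**`isIsogenous_twelve_biproduct_four`** (`A₁₂ ∼ ⨁_{Fin 2} A₄` for EVERY realisation `A₁₂` of `Φ_{12}` and `A₄` of `Φ_4`),
`nonempty_endAlgebra_twelve_algEquiv_matrix_four` (`End⁰(A₁₂) ≃ₐ[ℚ] Mat₂(ℚ(ζ_4))`), `finrank_hom_four_twelve`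
(`rk_ℤ Hom(A₁₂, A₄) = 4 = rk_ℤ Hom(A₄, A₁₂)`), `isSimple_four` ∕ `finrank_end_four` (bookkeeping: `A₄` simple, `rk_ℤ End(A₄) = 2`).

## Honest column ∕ NOT here

The curve; `J_{12} ∼ X_3² × X_4³` as a biproduct re-association and `End⁰(J_{12}) ≅ Mat₂(ℚ(ζ_3)) × Mat₃(ℚ(i))` are not spelled out
(only the level-`12` block and the `Hom` ranks); other pairs `(4, 4k)` are orthogonal for `φ(4k) ≠ 4` (F13
`orthogonal_four_fourDvd_of_totient_ne_four`), `(4, 8)` (F12).  `HC_CM` is not touched.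

## References

* [GalleseGoodsonLombardo2024] A. Gallese, H. Goodson, D. Lombardo, arXiv:2405.20394 — §3 Thm. 3.0 (5) and last statement, §3.2 Lemma 12.
* [MumfordAV1970] D. Mumford, *Abelian Varieties* — §19 Cor. 2 of Thm. 1 (p. 174), Cor. 2 of Thm. 3.
* [MilneCM2006] J. S. Milne, *Complex Multiplication* — Ch. I §3 Prop. 3.13, §5 Prop. 5.2.
* [Shimura1998] G. Shimura — §6.2 Thm. 3, §5.1 Prop. 3.
* [DeligneMilne1982Tannakian] P. Deligne, J. S. Milne, LNM 900 II — §6 Thm. 6.20 (Riemann).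

## Provenance

Cell `pub-hodgecm2` (COR-CM), KEPT Literature lane `lit-deligne-3` gen 51 (claim GGL24-LEVEL-TWELVE; count-neutral, own lane).
-/

noncomputable section

open CategoryTheory CategoryTheory.Limits NumberField Module

namespace Literature.AlgebraicGeometry.ComplexMultiplication

open Literature.AlgebraicGeometry.Motives
open Literature.AlgebraicGeometry.HodgeTheory (complexBetti)
open Literature.NumberTheory.ComplexMultiplication
open Literature.AlgebraicGeometry.Milne1999 (isIsogeny_biproduct_map)

namespace HyperellipticJacobian

open Literature.AlgebraicGeometry.Pohlmann1968 Literature.AlgebraicGeometry.Pohlmann1968.Cyclotomic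

section Twelve

variable {K₄ : Type} [Field K₄] [NumberField K₄] [IsCyclotomicExtension {4} ℚ K₄] {Φ₄ : CMType K₄}
  {A₄ : AbelianVariety ℂ} {ι₄ : 𝓞 K₄ →+* End A₄} {θ₄ : K₄ →+* Module.End ℂ (complexBetti A₄.X 1)}
  {K₁₂ : Type} [Field K₁₂] [NumberField K₁₂] [IsCyclotomicExtension {12} ℚ K₁₂] {Φ₁₂ : CMType K₁₂}
  {A₁₂ : AbelianVariety ℂ} {ι₁₂ : 𝓞 K₁₂ →+* End A₁₂} {θ₁₂ : K₁₂ →+* Module.End ℂ (complexBetti A₁₂.X 1)}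

omit [IsCyclotomicExtension {4} ℚ K₄] in
/-- `[ℚ(ζ_4) : ℚ] = 2`. [folklore] -/
private theorem finrank_eq_two_of_four [IsCyclotomicExtension {4} ℚ K₄] : finrank ℚ K₄ = 2 := by
  haveI : NeZero (4 : ℕ) := ⟨by norm_num⟩
  rw [IsCyclotomicExtension.finrank (K := ℚ) (n := 4) K₄ (Polynomial.cyclotomic.irreducible_rat (by norm_num))]
  decide +kernel

/-- **`X_4` is simple**: every realisation of a type of `ℚ(ζ_4) = ℚ(i)` is simple (the type is primitive — tree
`CMTypeLattice.primitive_of_finrank_eq_two` — and simple ⟺ primitive, Shimura §8.2 Prop. 26, tree `isSimple_iff_primitive`).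
[cite: Shimura1998, §8.2 Prop. 26 and §8.4 Example (1)] -/
theorem isSimple_four (hA₄ : IsCMTypeRealisation Φ₄ A₄ ι₄ θ₄) : A₄.IsSimple :=
  (isSimple_iff_primitive hA₄).2 (CMTypeLattice.primitive_of_finrank_eq_two Φ₄ finrank_eq_two_of_four)

/-- `rk_ℤ End(A₄) = 2 = [ℚ(i) : ℚ]` for a realisation of a type of `ℚ(ζ_4)`. [cite: MilneCM2006, Ch. I §3 Prop. 3.13 and §5 Prop. 5.2] -/
theorem finrank_end_four (hA₄ : IsCMTypeRealisation Φ₄ A₄ ι₄ θ₄) : Module.finrank ℤ (A₄ ⟶ A₄) = 2 := by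
  rw [hA₄.finrank_hom_eq_finrank_of_ringEquiv hA₄ (isSimple_four hA₄) (RingEquiv.refl K₄) fun u => Iff.rfl,
    finrank_eq_two_of_four]

/-- **`X_{12} ∼ X_4 × X_4`**: every realisation `A₁₂` of the lower-half type `Φ_{12}` of `ℚ(ζ_{12})` is isogenous to the biproduct
of two copies of any realisation `A₄` of the lower-half type `Φ_4` of `ℚ(ζ_4)` — `A₁₂ ∼ B ⊕ B` with `B` simple realising the
primitive sub-pair (Thm. 3.0 (5), tree `exists_isogeny_sq_simple_of_four_dvd`), `Hom(B, A₄) ≠ 0` (the compatible pair of F12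
restricted to `K₁`), and a non-zero homomorphism between the simple `B` and `A₄` is an isogeny (Mumford §19 Cor. 2 of Thm. 1).
[cite: GalleseGoodsonLombardo2024, §3 Thm. 3.0 (5) and §3.2 Lemma 12] [cite: MumfordAV1970, §19 Cor. 2 of Thm. 1 (p. 174)]
[cite: MilneCM2006, Ch. I §3 Prop. 3.13] [cite: Shimura1998, §6.2 Thm. 3] -/
theorem isIsogenous_twelve_biproduct_four (hΦ₄ : ∀ σ : K₄ →+* ℂ, σ ∈ Φ₄.1 ↔ 2 * (expOf 4 K₄ σ).val < 4)
    (hA₄ : IsCMTypeRealisation Φ₄ A₄ ι₄ θ₄)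
    (hΦ₁₂ : ∀ σ : K₁₂ →+* ℂ, σ ∈ Φ₁₂.1 ↔ 2 * (expOf 12 K₁₂ σ).val < 12) (hA₁₂ : IsCMTypeRealisation Φ₁₂ A₁₂ ι₁₂ θ₁₂) :
    AbelianVariety.IsIsogenous A₁₂ (⨁ fun _ : Fin 2 => A₄) := by
  haveI : NeZero (12 : ℕ) := ⟨by norm_num⟩
  -- Thm. 3.0 (5) at level 12: `A₁₂ ∼ P ≅ B ⊕ B`, `B` simple realising the primitive sub-pair `(K₁; Φ₁)`
  obtain ⟨-, K₁, Φ₁, B, ιB, θB, -, h₁, -, -, hB, hBs, -, P, π, ⟨hP⟩, g, hg, -⟩ :=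
    exists_isogeny_sq_simple_of_four_dvd (m := 12) ⟨3, rfl⟩ (by norm_num) (by norm_num) (by norm_num) (by norm_num) Φ₁₂ hΦ₁₂ hA₁₂
  -- the compatible pair for `(Φ_4, Φ_12)` restricts to one for `(Φ_4, Φ₁)`
  obtain ⟨s, t, hst⟩ := exists_compatible_four_twelve (Φ₄ := Φ₄) (Φ₁₂ := Φ₁₂) hΦ₄ hΦ₁₂
  have hst₁ : ∀ τ : ℂ ≃+* ℂ,
      (τ : ℂ →+* ℂ).comp (t.comp (algebraMap K₁ K₁₂)) ∈ Φ₁.1 ↔ (τ : ℂ →+* ℂ).comp s ∈ Φ₄.1 := by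
    intro τ
    rw [hst τ, ← h₁, mem_inducedCMType_iff, RingHom.comp_assoc]
  -- `Hom(B, A₄) ≠ 0`, both simple ⟹ an isogeny `B → A₄`
  obtain ⟨f, hf⟩ := (hB.exists_hom_ne_zero_iff hA₄).2 ⟨t.comp (algebraMap K₁ K₁₂), s, hst₁⟩
  have hfiso : AbelianVariety.IsIsogeny f := AbelianVariety.isIsogeny_of_isSimple_of_ne_zero hBs (isSimple_four hA₄) f hf
  -- `P ≅ B ⊕ B` (both are limit fans), then `⊕ f : B ⊕ B → A₄ ⊕ A₄`
  let e : P ≅ ⨁ fun _ : Fin 2 => B := hP.conePointUniqueUpToIso (biproduct.isLimit fun _ : Fin 2 => B)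
  have he : AbelianVariety.IsIsogeny e.hom := HodgeTheory.AbelianVariety.isIsogeny_of_isIso e.hom
  have hmap : AbelianVariety.IsIsogeny (biproduct.map fun _ : Fin 2 => f) := isIsogeny_biproduct_map fun _ => hfiso
  exact ⟨g ≫ e.hom ≫ biproduct.map fun _ : Fin 2 => f,
    AbelianVariety.isIsogeny_comp hg (AbelianVariety.isIsogeny_comp he hmap)⟩

/-- **`End⁰(X_{12}) ≃ₐ[ℚ] Mat₂(ℚ(ζ_4))`** — from `X_{12} ∼ X_4²`, `End⁰` an isogeny invariant, `End⁰(A²) = Mat₂(End⁰ A)` and `End⁰(X_4) = ℚ(ζ_4)`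
(compare Lemma 14 (2): `Mat₂(ℚ(ζ_{12} − ζ_{12}⁻¹))`, the same algebra since `ℚ(ζ_{12} − ζ_{12}⁻¹) = ℚ(i)`).
[cite: GalleseGoodsonLombardo2024, §3.5 Lemma 14 (2) and §3 Thm. 3.0 (5)] [cite: MumfordAV1970, §19 Cor. 2 of Thm. 3 and p. 174]
[cite: Shimura1998, §5.1 Prop. 3 (proof) and Prop. 6] -/
theorem nonempty_endAlgebra_twelve_algEquiv_matrix_four (hΦ₄ : ∀ σ : K₄ →+* ℂ, σ ∈ Φ₄.1 ↔ 2 * (expOf 4 K₄ σ).val < 4)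
    (hA₄ : IsCMTypeRealisation Φ₄ A₄ ι₄ θ₄)
    (hΦ₁₂ : ∀ σ : K₁₂ →+* ℂ, σ ∈ Φ₁₂.1 ↔ 2 * (expOf 12 K₁₂ σ).val < 12) (hA₁₂ : IsCMTypeRealisation Φ₁₂ A₁₂ ι₁₂ θ₁₂) :
    Nonempty (A₁₂.endAlgebra ≃ₐ[ℚ] Matrix (Fin 2) (Fin 2) K₄) := by
  obtain ⟨e₁⟩ := (isIsogenous_twelve_biproduct_four hΦ₄ hA₄ hΦ₁₂ hA₁₂).nonempty_endAlgebra_algEquiv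
  obtain ⟨e₂⟩ := nonempty_matrix_algEquiv_endAlgebra_biproduct_const A₄ 2
  obtain ⟨e₃⟩ := hA₄.nonempty_endAlgebra_algEquiv_of_primitive
    (CMTypeLattice.primitive_of_finrank_eq_two Φ₄ finrank_eq_two_of_four)
  exact ⟨(e₁.trans e₂.symm).trans e₃.mapMatrix⟩

/-- **`rk_ℤ Hom(X_{12}, X_4) = 4 = rk_ℤ Hom(X_4, X_{12})`** (`= 2 · rk_ℤ End(X_4)`, as for `Hom(X_4², X_4)`): the numerical form of
`X_{12} ∼ X_4²`. [cite: GalleseGoodsonLombardo2024, §3 Thm. 3.0 (5)] [cite: MilneCM2006, Ch. I §5 Prop. 5.2]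
[cite: MumfordAV1970, §19 (p. 174)] -/
theorem finrank_hom_four_twelve (hΦ₄ : ∀ σ : K₄ →+* ℂ, σ ∈ Φ₄.1 ↔ 2 * (expOf 4 K₄ σ).val < 4)
    (hA₄ : IsCMTypeRealisation Φ₄ A₄ ι₄ θ₄)
    (hΦ₁₂ : ∀ σ : K₁₂ →+* ℂ, σ ∈ Φ₁₂.1 ↔ 2 * (expOf 12 K₁₂ σ).val < 12) (hA₁₂ : IsCMTypeRealisation Φ₁₂ A₁₂ ι₁₂ θ₁₂) :
    Module.finrank ℤ (A₁₂ ⟶ A₄) = 4 ∧ Module.finrank ℤ (A₄ ⟶ A₁₂) = 4 := by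
  classical
  have h1 : Module.finrank ℤ (A₁₂ ⟶ A₄) = 4 := by
    rw [AbelianVariety.finrank_hom_eq_of_isIsogenous A₄ (isIsogenous_twelve_biproduct_four hΦ₄ hA₄ hΦ₁₂ hA₁₂),
      AbelianVariety.finrank_hom_biproduct_const A₄ A₄, Fintype.card_fin, finrank_end_four hA₄]
  exact ⟨h1, by rw [hA₄.finrank_hom_comm hA₁₂, h1]⟩

end Twelve

end HyperellipticJacobian

end Literature.AlgebraicGeometry.ComplexMultiplication

end
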